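/- COR-CM (cell pub-hodgecm2) — Δ2 BRIDGE, ORIENTATION AUDIT, TEST T2 WITH (D) DISCHARGED, wall-breaker wb-1 gen 1
(prover-pub-hodgecm2-d2bridge-wb-1-g1-0), CONJUGATION-TRANSPORT seat.  THEOREMS ONLY; nothing landed is edited or restated;
no named fact, no notation, no `sorry`.  FRAMING: HC_CM is NOT proved; «Δ2 BRIDGE CLOSED» is NOT claimed. -/
import Summits.HodgeConjecture.CorCM.D2Bridge.OrientationT2BlockVanishing
import Summits.HodgeConjecture.CorCM.D2Bridge.CmClassesHodgeType
import Summits.HodgeConjecture.CorCM.D2Bridge.OrientationReflexConj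
import HarnessLib

/-!
# Δ2 bridge, orientation test T2 with the typed (D) DISCHARGED by the conjugate-admissibility reading

wb-9's `OrientationT2BlockVanishing` closes ORIENTATION-MEMO §4 (T2) MODULO one typed binder (D) «below a threshold every
`K`-fixed vector of the `PhiMu` block restricts into `H^{0,1}(P_K)`», which is [Liu2021, (4.2) ∕ Prop. 4.13] read at the PATH-A
pin `τ' = ῑ₁` and not a tree theorem.  This file replaces (D) by an END-SHAPED hypothesis that the Δ2 lane's BY-VALUE terms at the
geometric instance `ῑ₁ = conj ∘ ι₁` inhabit: the combined reading `Thm418C` of the SAME tower dictionary with ONLY the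
admissibility comprehension re-keyed,

  `𝔇ʰ := LiuDictionary.ofTower … I Adm Ω (fun i => PhiMuLine ι₁ (line i)) (fun i d => d.IsReflexOfTypeG ῑ₁ (typeOfLine (line i)))`

(«hybrid»: `PhiMu` at `ι₁` as in the port, `adm` at `ῑ₁` as the tree's own J-record ∕ S1 at the cofan's instance supply it —
✔ `AlbaneseOnPieceCofan` :181, ✔ `HcmS1PinJunction.exists_dLiu_of_objOne` at `hinst : algebraMap = ῑ₁`).  `𝔇ʰ` has the SAME
`H`, `block`, `res`, `Char`, `Adm`, `Ω`, `PhiMu` as the pinned dictionary `𝔇 := liuDictionaryPin … V I line` (definitionally — only the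
field `adm` differs), so no new object is defined here.

* §1 `res_block_mem_piece_zero_one_of_thm418C` — for two tower dictionaries sharing the adèlic side, `Thm418C` of the one whose
  admissible records at `μ` have their eigencharacter OUTSIDE their CM type (`d.τ ∉ d.ΦA`, classes of type `(0,1)` by ✔
  `cmClasses_subset_hodge_piece_zero_one`) IS the typed (D) for the other.
* §2 at the literal pin, `L/ℚ` Galois: `res_block_pin_mem_piece_zero_one_of_thm418C_conjAdm` ((D) from `𝔇ʰ.Thm418C`, via own-crow's
  ✔ `tau_notMem_cmType_of_isReflexOfType_starRingEnd_comp`); **`block_pin_eq_bot_of_thm418C_of_thm418C_conjAdm`**: `𝔇.Thm418C`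
  (the END's `h418`, keyed `ι₁`) ∧ `𝔇ʰ.Thm418C` ⟹ `𝔇.block i = ⊥` at every `PhiMu` line (wb-9's theorem with (T1) := ✔
  `cmClasses_subset_hodge_piece_one_zero_pin` and (D) := §2); **`res_eq_zero_of_thm418C_conjAdm_of_mem_F_one`**: under `𝔇ʰ.Thm418C`
  alone, NO non-zero HOLOMORPHIC (`F¹`) level class is the restriction of a `K`-fixed vector of a `PhiMu` block (wb-9 §4b) — in
  particular (`eq_zero_of_thm418C_conjAdm_of_hJS`) every class `ω ∈ Θ ⊆ F¹H¹(P_Γ)` carried by an `hJS`-witness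
  (`∃ cf, res cf = ω ∧ ofLevel cf ∈ block i`, the binder shape of the theta junction `HThetaJunctionR2BGal`) is ZERO.
READING.  (i) Kernel form of the MIS-KEY finding: the port's `ι₁`-keyed `h418` and the `ῑ₁`-keyed reading coexist only on vanishing
`PhiMu` blocks.  (ii) `𝔇ʰ.Thm418C` is what ✔ `PinSignatures.thm418C_ofTower_of_pins` yields at
`(PhiMu, adm) := (PhiMuLine ι₁ ∘ line, IsReflexOfTypeG ῑ₁ ∘ typeOfLine ∘ line)` from edition-1's (a)(b) binders and cites VERBATIM
(`hLiu` at `μ_i`, Ω-pin, `h413`, `h411`, `hsep`, `hnvD`, `hK`, `hbad`) together with (c)(d) binders typed at `𝔇ʰ.cmClasses`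
(the shape the re-key lane's by-value terms at instance `ῑ₁` for the character `μ_i` are built to inhabit, with `τ' := ι₁`,
`hτ' := PhiMu i`); so, ONCE those terms land, edition-1's citation family forces every holomorphic class placed in a `PhiMu` block by
an `hJS`-witness to vanish — independently of how `h418` is keyed.  Nothing here asserts that any binder is inhabited.
-/

set_option autoImplicit false
noncomputable section

namespace Summit.HodgeConjecture.CorCM.D2Bridge

open HodgeCM HodgeCM.Model
open HodgeCM.Model.TowerCarrier HodgeCM.Model.TowerLevel
open HodgeCM.Literature.Theta HodgeCM.Literature.Theta.LiuAlbaneseModuleDatum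
open Literature.AlgebraicGeometry.HodgeTheory
open Literature.NumberTheory.Automorphic.PicardCM
open Literature.NumberTheory.Transcendental (Arapura2012_Cor_15_4_6)

variable {L : CMField} {ι₁ : L →+* ℂ}

/-! ## §1 Two tower dictionaries sharing the adèlic side: `Thm418C` of a `(0,1)`-keyed one IS the typed (D) of the other -/

section TwoReadings

variable (V : HermSpace3 L ι₁)
variable (Char : Type) (Adm : Char → Type) (Ω : (μ : Char) → Adm μ → Type)
    [∀ μ a, AddCommGroup (Ω μ a)] [∀ μ a, Module ℂ (Ω μ a)] [∀ μ a, Module (adelicAlgebra V) (Ω μ a)]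
    [∀ μ a, IsScalarTower ℂ (adelicAlgebra V) (Ω μ a)]
    (PhiMu PhiMu' : Char → Prop) (adm adm' : Char → LiuCMSide → Prop)

/-- **(D) from the conjugate reading.**  Two tower dictionaries `T := ofTower … PhiMu adm`, `T' := ofTower … PhiMu' adm'` with the same
adèlic side have the same `H`, `block μ`, `res` (definitionally).  If `T'.Thm418C` holds at a `PhiMu'`-character `μ` whose
`adm'`-admissible records have their eigencharacter OUTSIDE their CM type, then below a threshold every `K`-fixed vector of `block μ`
restricts into `H^{0,1}(P_K)` — the typed (D) of ORIENTATION-MEMO §3.1 for `T`. [cite: VoisinHodgeI2002, §7.1.1 Def. 7.4 and §7.3.2] -/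
theorem res_block_mem_piece_zero_one_of_thm418C (hHD : exists_isReal_hodgeModel) (hI : hodgePQ_independent_of_hodgeModel)
    (h₁ : BallQuotientUniformised) (h₃ : CMAbelianVarietyRealised) (hA : Arapura2012_Cor_15_4_6) (μ : Char)
    (h418' : (LiuDictionary.ofTower hHD hI h₁ h₃ hA V Char Adm Ω PhiMu' adm').Thm418C) (hΦ' : PhiMu' μ)
    (hadm' : ∀ d : LiuCMSide, adm' μ d → d.τ ∉ d.ΦA.1) :
    ∃ Γ₁ : Level V, ∀ Γ ≤ Γ₁, ∀ x ∈ (LiuDictionary.ofTower hHD hI h₁ h₃ hA V Char Adm Ω PhiMu adm).block μ,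
      x ∈ fixedBy Γ.K (LiuDictionary.ofTower hHD hI h₁ h₃ hA V Char Adm Ω PhiMu adm).H →
        (LiuDictionary.ofTower hHD hI h₁ h₃ hA V Char Adm Ω PhiMu adm).res Γ x ∈
          ((picardCMUniverse hHD hI h₁ h₃).hodge ((picardCMUniverse hHD hI h₁ h₃).pms L ι₁ V Γ) 1).piece 0 1 := by
  obtain ⟨K₀, hK₀⟩ := h418' μ hΦ'
  refine ⟨K₀, fun Γ hΓ x hx hfix => ?_⟩
  have hsub := cmClasses_subset_hodge_piece_zero_one
    (LiuDictionary.ofTower hHD hI h₁ h₃ hA V Char Adm Ω PhiMu' adm') Γ μ hadm'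
  exact Submodule.span_le.2 hsub (hK₀ Γ hΓ x hx hfix)

/-- **Two readings ⇒ vanishing.**  If `T.Thm418C` holds at `μ` with `adm`-records of type `(1,0)` (`d.τ ∈ d.ΦA`) and `T'.Thm418C`
holds at `μ` with `adm'`-records of type `(0,1)` (`d.τ ∉ d.ΦA`), then `block μ = ⊥` (wb-9's T2 with (D) := the previous theorem).
[cite: VoisinHodgeI2002, §6.1.3 Cor. 6.14] -/
theorem block_ofTower_eq_bot_of_thm418C_of_thm418C (hHD : exists_isReal_hodgeModel) (hI : hodgePQ_independent_of_hodgeModel)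
    (h₁ : BallQuotientUniformised) (h₃ : CMAbelianVarietyRealised) (hA : Arapura2012_Cor_15_4_6) (μ : Char)
    (h418 : (LiuDictionary.ofTower hHD hI h₁ h₃ hA V Char Adm Ω PhiMu adm).Thm418C) (hΦ : PhiMu μ)
    (hadm : ∀ d : LiuCMSide, adm μ d → d.τ ∈ d.ΦA.1)
    (h418' : (LiuDictionary.ofTower hHD hI h₁ h₃ hA V Char Adm Ω PhiMu' adm').Thm418C) (hΦ' : PhiMu' μ)
    (hadm' : ∀ d : LiuCMSide, adm' μ d → d.τ ∉ d.ΦA.1) :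
    (LiuDictionary.ofTower hHD hI h₁ h₃ hA V Char Adm Ω PhiMu adm).block μ = ⊥ :=
  block_ofTower_eq_bot_of_thm418C_of_hodgeTypes V Char Adm Ω PhiMu adm hHD hI h₁ h₃ hA μ h418 hΦ
    (fun Γ => by
      simpa using cmClasses_subset_hodge_piece_one_zero
        (LiuDictionary.ofTower hHD hI h₁ h₃ hA V Char Adm Ω PhiMu adm) Γ μ hadm)
    (res_block_mem_piece_zero_one_of_thm418C V Char Adm Ω PhiMu PhiMu' adm adm' hHD hI h₁ h₃ hA μ h418' hΦ' hadm')

/-- **Under the `(0,1)`-keyed reading alone: no non-zero holomorphic level class in the block.**  If `T'.Thm418C` holds at `μ` with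
`adm'`-records of type `(0,1)`, then every `K`-fixed vector of `block μ` at ANY tower level `Γ` whose restriction on `P_Γ` lies in
`F¹H¹(P_Γ)` restricts to `0` (wb-9 §4b: pass to `Γ ⊓ Γ₁` along the injective, `F¹`-preserving level covering; `F¹ ∩ H^{0,1} = 0`).
[cite: VoisinHodgeI2002, §7.3.2] -/
theorem res_eq_zero_of_thm418C_of_mem_F_one (hHD : exists_isReal_hodgeModel) (hI : hodgePQ_independent_of_hodgeModel)
    (h₁ : BallQuotientUniformised) (h₃ : CMAbelianVarietyRealised) (hA : Arapura2012_Cor_15_4_6) (μ : Char)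
    (h418' : (LiuDictionary.ofTower hHD hI h₁ h₃ hA V Char Adm Ω PhiMu' adm').Thm418C) (hΦ' : PhiMu' μ)
    (hadm' : ∀ d : LiuCMSide, adm' μ d → d.τ ∉ d.ΦA.1)
    (Γ : Level V) (hΓ : Γ.BelowConjThree) (x : (LiuDictionary.ofTower hHD hI h₁ h₃ hA V Char Adm Ω PhiMu adm).H)
    (hx : x ∈ (LiuDictionary.ofTower hHD hI h₁ h₃ hA V Char Adm Ω PhiMu adm).block μ)
    (hfix : x ∈ fixedBy Γ.K (LiuDictionary.ofTower hHD hI h₁ h₃ hA V Char Adm Ω PhiMu adm).H)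
    (hF : (LiuDictionary.ofTower hHD hI h₁ h₃ hA V Char Adm Ω PhiMu adm).res Γ x ∈
      ((picardCMUniverse hHD hI h₁ h₃).hodge ((picardCMUniverse hHD hI h₁ h₃).pms L ι₁ V Γ) 1).F 1) :
    (LiuDictionary.ofTower hHD hI h₁ h₃ hA V Char Adm Ω PhiMu adm).res Γ x = 0 := by
  by_contra hne
  exact not_block_res_subset_piece_zero_one_of_res_mem_F_one V Char Adm Ω PhiMu adm hHD hI h₁ h₃ hA μ Γ hΓ x hx hfix hF hne
    (res_block_mem_piece_zero_one_of_thm418C V Char Adm Ω PhiMu PhiMu' adm adm' hHD hI h₁ h₃ hA μ h418' hΦ' hadm')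

/-- **The theta-junction shape.**  Under the `(0,1)`-keyed reading at `μ`: every class `ω` of a family `Θ ⊆ F¹H¹(P_Γ)` (holomorphic
classes, e.g. `(pinD …).H10`-valued theta classes) that is carried by an `hJS`-witness — `∃ cf ∈ H_K, res cf = ω ∧ ofLevel cf ∈ block μ`,
the binder shape of `HThetaJunctionR2BGal.hsmall_of_tower_at_block_of_typeOf_gal` — is ZERO. [cite: VoisinHodgeI2002, §7.3.2] -/
theorem eq_zero_of_thm418C_of_hJS (hHD : exists_isReal_hodgeModel) (hI : hodgePQ_independent_of_hodgeModel)
    (h₁ : BallQuotientUniformised) (h₃ : CMAbelianVarietyRealised) (hA : Arapura2012_Cor_15_4_6) (μ : Char)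
    (h418' : (LiuDictionary.ofTower hHD hI h₁ h₃ hA V Char Adm Ω PhiMu' adm').Thm418C) (hΦ' : PhiMu' μ)
    (hadm' : ∀ d : LiuCMSide, adm' μ d → d.τ ∉ d.ΦA.1)
    (Γ : Level V) (hΓ : Γ.BelowConjThree)
    (Θ : Set ((picardCMUniverse hHD hI h₁ h₃).CohC ((picardCMUniverse hHD hI h₁ h₃).pms L ι₁ V Γ) 1))
    (hΘ : Θ ⊆ ((picardCMUniverse hHD hI h₁ h₃).hodge ((picardCMUniverse hHD hI h₁ h₃).pms L ι₁ V Γ) 1).F 1)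
    (hJS : ∀ ω ∈ Θ, ∃ cf : towerLevel hHD hI (ballQuotientUniformisedDatum_of h₁) h₃ hA Γ hΓ,
      TowerLevel.res hHD hI (ballQuotientUniformisedDatum_of h₁) h₃ hA cf = ω ∧
        (ofLevel hHD hI (ballQuotientUniformisedDatum_of h₁) h₃ hA Γ hΓ cf :
            (LiuDictionary.ofTower hHD hI h₁ h₃ hA V Char Adm Ω PhiMu adm).H) ∈
          (LiuDictionary.ofTower hHD hI h₁ h₃ hA V Char Adm Ω PhiMu adm).block μ) :
    ∀ ω ∈ Θ, ω = 0 := by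
  intro ω hω
  obtain ⟨cf, hres, hblock⟩ := hJS ω hω
  have hfix := LiuDictionary.ofLevel_mem_fixedBy hHD hI h₁ h₃ hA Char Adm Ω PhiMu adm hΓ cf
  -- on `H_K` the dictionary's `res Γ` (`= resTotal Γ`, `rfl`) is the value at the identity component
  have hresT : (LiuDictionary.ofTower hHD hI h₁ h₃ hA V Char Adm Ω PhiMu adm).res Γ
      (ofLevel hHD hI (ballQuotientUniformisedDatum_of h₁) h₃ hA Γ hΓ cf) = ω :=
    (resTotal_ofLevel hHD hI (ballQuotientUniformisedDatum_of h₁) h₃ hA Γ hΓ cf).trans hres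
  have hF : (LiuDictionary.ofTower hHD hI h₁ h₃ hA V Char Adm Ω PhiMu adm).res Γ
      (ofLevel hHD hI (ballQuotientUniformisedDatum_of h₁) h₃ hA Γ hΓ cf) ∈
        ((picardCMUniverse hHD hI h₁ h₃).hodge ((picardCMUniverse hHD hI h₁ h₃).pms L ι₁ V Γ) 1).F 1 :=
    hresT ▸ hΘ hω
  have h0 := res_eq_zero_of_thm418C_of_mem_F_one V Char Adm Ω PhiMu PhiMu' adm adm' hHD hI h₁ h₃ hA μ h418' hΦ' hadm' Γ hΓ
    _ hblock hfix hF
  exact hresT.symm.trans h0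

end TwoReadings

/-! ## §2 AT THE LITERAL PIN: the port's `ι₁`-keyed `𝔇` and the hybrid `𝔇ʰ` (admissibility re-keyed at `ῑ₁ = conj ∘ ι₁`) -/

section Pin

variable (V : HermSpace3 L ι₁) (I : Type) (line : I → SplitLineE V)

/-- **(D) AT THE LITERAL PIN from the hybrid reading.**  `L/ℚ` Galois.  If the hybrid dictionary `𝔇ʰ` (`PhiMu i = PhiMuLine ι₁ (line i)`,
`adm i d = d.IsReflexOfTypeG ῑ₁ (typeOfLine (line i))`) satisfies `Thm418C`, then at every `PhiMu` line `i` the typed (D) of wb-9 holds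
for the pinned dictionary `𝔇 = liuDictionaryPin … V I line`: through `ῑ₁` a record admissible for a type containing `ι₁` has its
eigencharacter OUTSIDE its CM type (own-crow), so `𝔇ʰ.cmClasses K i ⊆ H^{0,1}(P_K)`.
[cite: Liu2021, Remark 4.4 (TeX ll. 1930–1933)] [cite: Shimura1998, §8.3 Prop. 28] [cite: VoisinHodgeI2002, §7.1.1 Def. 7.4] -/
theorem res_block_pin_mem_piece_zero_one_of_thm418C_conjAdm [IsGalois ℚ L]
    (hHD : exists_isReal_hodgeModel) (hI : hodgePQ_independent_of_hodgeModel)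
    (h₁ : BallQuotientUniformised) (h₃ : CMAbelianVarietyRealised) (hA : Arapura2012_Cor_15_4_6) (i : I)
    (hΦ : SplitLine.PhiMuLine ι₁ (line i))
    (h418h : (LiuDictionary.ofTower hHD hI h₁ h₃ hA V I (fun i => {χ : (line i).CharW // (line i).IsAutChar χ})
      (fun i a => (line i).Ω (ιVE V) a.1) (fun i => SplitLine.PhiMuLine ι₁ (line i))
      (fun i dd => dd.IsReflexOfTypeG ((starRingEnd ℂ).comp ι₁) (SplitLine.typeOfLine (line i)))).Thm418C) :
    ∃ Γ₁ : Level V, ∀ Γ ≤ Γ₁, ∀ x ∈ (liuDictionaryPin hHD hI h₁ h₃ hA V I line).block i,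
      x ∈ fixedBy Γ.K (liuDictionaryPin hHD hI h₁ h₃ hA V I line).H →
        (liuDictionaryPin hHD hI h₁ h₃ hA V I line).res Γ x ∈
          ((picardCMUniverse hHD hI h₁ h₃).hodge ((picardCMUniverse hHD hI h₁ h₃).pms L ι₁ V Γ) 1).piece 0 1 :=
  res_block_mem_piece_zero_one_of_thm418C V I _ _ _ _ _ _ hHD hI h₁ h₃ hA i h418h hΦ
    (fun d hd => tau_notMem_cmType_of_isReflexOfType_starRingEnd_comp ι₁ d _ (hd inferInstance) hΦ)

/-- **T2 AT THE LITERAL PIN WITH (D) DISCHARGED: the port's `h418` (keyed `ι₁`) and the hybrid reading (admissibility keyed `ῑ₁`)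
coexist only on vanishing `PhiMu` blocks.**  `L/ℚ` Galois; (T1) is prove-8's ✔ `cmClasses_subset_hodge_piece_one_zero_pin`.
[cite: VoisinHodgeI2002, §6.1.3 Cor. 6.14] [cite: Shimura1998, §8.3 Prop. 28] -/
theorem block_pin_eq_bot_of_thm418C_of_thm418C_conjAdm [IsGalois ℚ L]
    (hHD : exists_isReal_hodgeModel) (hI : hodgePQ_independent_of_hodgeModel)
    (h₁ : BallQuotientUniformised) (h₃ : CMAbelianVarietyRealised) (hA : Arapura2012_Cor_15_4_6) (i : I)
    (hΦ : SplitLine.PhiMuLine ι₁ (line i))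
    (h418 : (liuDictionaryPin hHD hI h₁ h₃ hA V I line).Thm418C)
    (h418h : (LiuDictionary.ofTower hHD hI h₁ h₃ hA V I (fun i => {χ : (line i).CharW // (line i).IsAutChar χ})
      (fun i a => (line i).Ω (ιVE V) a.1) (fun i => SplitLine.PhiMuLine ι₁ (line i))
      (fun i dd => dd.IsReflexOfTypeG ((starRingEnd ℂ).comp ι₁) (SplitLine.typeOfLine (line i)))).Thm418C) :
    (liuDictionaryPin hHD hI h₁ h₃ hA V I line).block i = ⊥ :=
  block_pin_eq_bot_of_thm418C_of_hodgeTypes V I line hHD hI h₁ h₃ hA i h418 hΦ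
    (fun Γ => by simpa using cmClasses_subset_hodge_piece_one_zero_pin V I line Γ i hΦ)
    (res_block_pin_mem_piece_zero_one_of_thm418C_conjAdm V I line hHD hI h₁ h₃ hA i hΦ h418h)

/-- Inconsistency form: with a non-zero `PhiMu` block the two readings are contradictory. [cite: VoisinHodgeI2002, §6.1.3 Cor. 6.14] -/
theorem false_of_thm418C_of_thm418C_conjAdm_of_block_ne_bot [IsGalois ℚ L]
    (hHD : exists_isReal_hodgeModel) (hI : hodgePQ_independent_of_hodgeModel)
    (h₁ : BallQuotientUniformised) (h₃ : CMAbelianVarietyRealised) (hA : Arapura2012_Cor_15_4_6) (i : I)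
    (hΦ : SplitLine.PhiMuLine ι₁ (line i))
    (h418 : (liuDictionaryPin hHD hI h₁ h₃ hA V I line).Thm418C)
    (h418h : (LiuDictionary.ofTower hHD hI h₁ h₃ hA V I (fun i => {χ : (line i).CharW // (line i).IsAutChar χ})
      (fun i a => (line i).Ω (ιVE V) a.1) (fun i => SplitLine.PhiMuLine ι₁ (line i))
      (fun i dd => dd.IsReflexOfTypeG ((starRingEnd ℂ).comp ι₁) (SplitLine.typeOfLine (line i)))).Thm418C)
    (hne : (liuDictionaryPin hHD hI h₁ h₃ hA V I line).block i ≠ ⊥) : False :=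
  hne (block_pin_eq_bot_of_thm418C_of_thm418C_conjAdm V I line hHD hI h₁ h₃ hA i hΦ h418 h418h)

/-- **STARVATION AT THE LITERAL PIN under the hybrid reading alone.**  `L/ℚ` Galois.  If `𝔇ʰ.Thm418C` holds, then at every `PhiMu`
line `i` and every tower level `Γ`, a `K`-fixed vector of `𝔇.block i` whose restriction on `P_Γ` is HOLOMORPHIC (`∈ F¹H¹(P_Γ)`) restricts
to `0` — the port's `h418` is not used. [cite: VoisinHodgeI2002, §7.3.2] [cite: Shimura1998, §8.3 Prop. 28] -/
theorem res_eq_zero_of_thm418C_conjAdm_of_mem_F_one [IsGalois ℚ L]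
    (hHD : exists_isReal_hodgeModel) (hI : hodgePQ_independent_of_hodgeModel)
    (h₁ : BallQuotientUniformised) (h₃ : CMAbelianVarietyRealised) (hA : Arapura2012_Cor_15_4_6) (i : I)
    (hΦ : SplitLine.PhiMuLine ι₁ (line i))
    (h418h : (LiuDictionary.ofTower hHD hI h₁ h₃ hA V I (fun i => {χ : (line i).CharW // (line i).IsAutChar χ})
      (fun i a => (line i).Ω (ιVE V) a.1) (fun i => SplitLine.PhiMuLine ι₁ (line i))
      (fun i dd => dd.IsReflexOfTypeG ((starRingEnd ℂ).comp ι₁) (SplitLine.typeOfLine (line i)))).Thm418C)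
    (Γ : Level V) (hΓ : Γ.BelowConjThree) (x : (liuDictionaryPin hHD hI h₁ h₃ hA V I line).H)
    (hx : x ∈ (liuDictionaryPin hHD hI h₁ h₃ hA V I line).block i)
    (hfix : x ∈ fixedBy Γ.K (liuDictionaryPin hHD hI h₁ h₃ hA V I line).H)
    (hF : (liuDictionaryPin hHD hI h₁ h₃ hA V I line).res Γ x ∈
      ((picardCMUniverse hHD hI h₁ h₃).hodge ((picardCMUniverse hHD hI h₁ h₃).pms L ι₁ V Γ) 1).F 1) :
    (liuDictionaryPin hHD hI h₁ h₃ hA V I line).res Γ x = 0 :=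
  res_eq_zero_of_thm418C_of_mem_F_one V I _ _ _ _ _ _ hHD hI h₁ h₃ hA i h418h hΦ
    (fun d hd => tau_notMem_cmType_of_isReflexOfType_starRingEnd_comp ι₁ d _ (hd inferInstance) hΦ) Γ hΓ x hx hfix hF

/-- **The theta-junction shape at the literal pin.**  `L/ℚ` Galois.  Under `𝔇ʰ.Thm418C`: at a `PhiMu` line `i`, every HOLOMORPHIC class
`ω ∈ Θ ⊆ F¹H¹(P_Γ)` with an `hJS`-witness in `𝔇.block i` (`∃ cf ∈ H_K, res cf = ω ∧ ofLevel cf ∈ 𝔇.block i` — the binder by which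
`HThetaJunctionR2BGal` places Stage 1's theta classes in the blocks) is ZERO. [cite: VoisinHodgeI2002, §7.3.2] [cite: Shimura1998, §8.3 Prop. 28] -/
theorem eq_zero_of_thm418C_conjAdm_of_hJS [IsGalois ℚ L]
    (hHD : exists_isReal_hodgeModel) (hI : hodgePQ_independent_of_hodgeModel)
    (h₁ : BallQuotientUniformised) (h₃ : CMAbelianVarietyRealised) (hA : Arapura2012_Cor_15_4_6) (i : I)
    (hΦ : SplitLine.PhiMuLine ι₁ (line i))
    (h418h : (LiuDictionary.ofTower hHD hI h₁ h₃ hA V I (fun i => {χ : (line i).CharW // (line i).IsAutChar χ})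
      (fun i a => (line i).Ω (ιVE V) a.1) (fun i => SplitLine.PhiMuLine ι₁ (line i))
      (fun i dd => dd.IsReflexOfTypeG ((starRingEnd ℂ).comp ι₁) (SplitLine.typeOfLine (line i)))).Thm418C)
    (Γ : Level V) (hΓ : Γ.BelowConjThree)
    (Θ : Set ((picardCMUniverse hHD hI h₁ h₃).CohC ((picardCMUniverse hHD hI h₁ h₃).pms L ι₁ V Γ) 1))
    (hΘ : Θ ⊆ ((picardCMUniverse hHD hI h₁ h₃).hodge ((picardCMUniverse hHD hI h₁ h₃).pms L ι₁ V Γ) 1).F 1)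
    (hJS : ∀ ω ∈ Θ, ∃ cf : towerLevel hHD hI (ballQuotientUniformisedDatum_of h₁) h₃ hA Γ hΓ,
      TowerLevel.res hHD hI (ballQuotientUniformisedDatum_of h₁) h₃ hA cf = ω ∧
        (ofLevel hHD hI (ballQuotientUniformisedDatum_of h₁) h₃ hA Γ hΓ cf : (liuDictionaryPin hHD hI h₁ h₃ hA V I line).H) ∈
          (liuDictionaryPin hHD hI h₁ h₃ hA V I line).block i) :
    ∀ ω ∈ Θ, ω = 0 :=
  eq_zero_of_thm418C_of_hJS V I _ _ _ _ _ _ hHD hI h₁ h₃ hA i h418h hΦ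
    (fun d hd => tau_notMem_cmType_of_isReflexOfType_starRingEnd_comp ι₁ d _ (hd inferInstance) hΦ) Γ hΓ Θ hΘ hJS

end Pin

end Summit.HodgeConjecture.CorCM.D2Bridge

end
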